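import Literature.LinearAlgebra.Alternating.WedgeWordsSorted
import Literature.LinearAlgebra.Alternating.DerivationExtension
import Mathlib.LinearAlgebra.Dimension.StrongRankCondition
import Mathlib.LinearAlgebra.Dimension.OrzechProperty
import Mathlib.LinearAlgebra.FreeModule.Finite.Basic
import Mathlib.Data.Finset.Powerset
import HarnessLib

/-!
# Monomials of LETTER SETS: the basis `{θ_S ∧ c}_{#S = k}` of `Alt^k` from a spanning alphabet of the right size,
# its coordinates, and the Leibniz action `ad T (θ₁ ∧ ⋯ ∧ θ_k) = Σⱼ θ₁ ∧ ⋯ ∧ (θⱼ ∘ T) ∧ ⋯ ∧ θ_k` of an operator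

Layer `Literature/LinearAlgebra/Alternating`, namespace `Literature.LinearAlgebra.Alternating`; lane `lit-hodgefound`
(Track 2 foundations library, Layer A4), seat `lit-hodgefound-skel-4`, programme row **A4-81** FILE B0 (the
order-free monomial basis and the derivation action used by the invariant computation of van Geemen's Thm. 6.12,
`HodgeTheory/WeilFamilyInvariantFormsAllDegrees`).  Sequel, BY NAME, of `WedgeWords` / `WedgeWordsDet` /
`WedgeWordsSorted` (p06/p19: the monomials `wedgeWord θ c k w = θ_{w 0} ∧ ⋯ ∧ θ_{w (k-1)} ∧ c` of words in an
alphabet of `1`-forms, the determinant formula, alternation in the word, `wedgeSeq` and its multilinearity in the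
letters) and of `DerivationExtension` (p06: `adAlt T`, its Leibniz rule `adAlt_wedgeOne` for `θ ∧ η`).

## Sources

* Warner (1983), 2.6: for a basis `ω¹, …, ωⁿ` of `V^*`, «`{ω^{i₁} ∧ ⋯ ∧ ω^{i_r} : i₁ < ⋯ < i_r}` is a basis of
  `Λ_r(V)`» — one basis vector per `r`-element SUBSET of the alphabet; Lange–Birkenhake (1992) / Lange (2023),
  §1.1.4 Prop. 1.1.20 and §1.1.5 Prop. 1.1.23 (the `dx_I`, resp. `dz_I ∧ dz̄_J`, `#I + #J = k`, form a basis of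
  `⋀^k Hom_ℝ(V, ℂ)`): here in the ORDER-FREE form — the basis is indexed by the `k`-element subsets `S` of the
  alphabet, each represented by some enumeration `setWord S` (no linear order on the alphabet is used), and it is a
  basis as soon as the monomials span and the alphabet has the right size (`#{S} = C(#alphabet, k) = dim`), by
  Mathlib's `basisOfTopLeSpanOfCardEqFinrank`; this covers alphabets WITHOUT dual vectors, e.g. the letters
  `dz_j, dz̄_j` of a complex frame acting on REAL vectors.
* Verbitsky (1996), §1: «We extend it on `i`-forms for arbitrary `i` using Leibnitz formula» — iterated on a
  monomial: `ad T (θ₁ ∧ ⋯ ∧ θ_k ∧ c) = Σⱼ θ₁ ∧ ⋯ ∧ (θⱼ ∘ T) ∧ ⋯ ∧ θ_k ∧ c` (`adAlt_wedgeSeq`), so a monomial in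
  EIGEN-letters of `T` is an eigen-form with the sum of the eigenvalues (`adAlt_wedgeSeq_of_comp_eq_smul`) — the
  weights of a diagonal torus on `⋀^k`, as used in van Geemen (1994), proof of Thm. 6.12.

## What is here

* §1 `setWord S hS : Fin k → Λ` (an enumeration of a `k`-set of letters), `setMonomial θ c S = θ_{setWord S} ∧ c`;
  every injective word is a reordering of the set word of its image (`exists_perm_setWord_comp_eq`), so the set
  monomials span what all monomials span (`span_setMonomial_eq`); `setMonomialBasis` (hypotheses: the monomials of
  length `k` span, and `finrank = C(#Λ, k)`), its coordinates on monomials of arbitrary words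
  (`coord_wedgeWord_eq_zero_of_image_ne`, `…_of_not_injective`), sums over a set word (`sum_setWord`).
* §2 `adAlt_wedgeSeq`, `adAlt_wedgeWord` (Leibniz on monomials), `adAlt_wedgeSeq_of_comp_eq_smul` (eigen-letters).

No named fact (D-0026); two small definitions with bodies (`setWord`, `setMonomial`) and one `Module.Basis`.

## References

* [Warner1983] F. W. Warner, *Foundations of Differentiable Manifolds and Lie Groups* (1983), 2.6.
* [Lange2023AbelianVarietiesComplex] H. Lange, *Abelian Varieties over the Complex Numbers* (2023), §1.1.4
  Prop. 1.1.20, §1.1.5 Prop. 1.1.23.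
* [Verbitsky1996Hyperholomorphic] M. Verbitsky, *Hyperholomorphic bundles over a hyperkähler manifold* (1996), §1.
* [vanGeemen1994HodgeAV] B. van Geemen, LNM 1594 (1994), proof of Thm. 6.12.
-/

noncomputable section

open Function Finset

namespace Literature.LinearAlgebra.Alternating

/-! ## §1 Set words, set monomials, the order-free monomial basis -/

section SetWords

variable {𝕜 : Type*} [NontriviallyNormedField 𝕜] {𝕜' : Type*} [NormedField 𝕜'] [NormedAlgebra 𝕜 𝕜']
  {E : Type*} [NormedAddCommGroup E] [NormedSpace 𝕜 E]
  {F : Type*} [NormedAddCommGroup F] [NormedSpace 𝕜 F] [NormedSpace 𝕜' F] [IsScalarTower 𝕜 𝕜' F]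
  {Λ : Type*}

/-- An enumeration `Fin k → Λ` of a `k`-element set `S` of letters (Mathlib's `Finset.equivFinOfCardEq`; no order on
the alphabet is used — Warner's increasing words `i₁ < ⋯ < i_r` are ONE such choice).
[cite: Warner1983, 2.6 («{ω^{i₁} ∧ ⋯ ∧ ω^{i_r}}», one monomial per r-subset)] -/
def setWord {k : ℕ} (S : Finset Λ) (hS : S.card = k) : Fin k → Λ :=
  fun j ↦ ((S.equivFinOfCardEq hS).symm j).1

/-- The letters of `setWord S` lie in `S`. [cite: Warner1983, 2.6] -/
theorem setWord_mem {k : ℕ} (S : Finset Λ) (hS : S.card = k) (j : Fin k) : setWord S hS j ∈ S :=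
  ((S.equivFinOfCardEq hS).symm j).2

/-- `setWord S` is injective. [cite: Warner1983, 2.6] -/
theorem setWord_injective {k : ℕ} (S : Finset Λ) (hS : S.card = k) : Injective (setWord S hS) :=
  fun _ _ h ↦ (S.equivFinOfCardEq hS).symm.injective (Subtype.ext h)

/-- Every letter of `S` occurs in `setWord S`. [cite: Warner1983, 2.6] -/
theorem exists_setWord_eq {k : ℕ} (S : Finset Λ) (hS : S.card = k) {a : Λ} (ha : a ∈ S) :
    ∃ j, setWord S hS j = a :=
  ⟨S.equivFinOfCardEq hS ⟨a, ha⟩, by simp [setWord]⟩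

/-- The image of `setWord S` is `S`. [cite: Warner1983, 2.6] -/
theorem image_setWord [DecidableEq Λ] {k : ℕ} (S : Finset Λ) (hS : S.card = k) :
    Finset.univ.image (setWord S hS) = S := by
  ext a
  simp only [Finset.mem_image, Finset.mem_univ, true_and]
  exact ⟨fun ⟨j, hj⟩ ↦ hj ▸ setWord_mem S hS j, fun ha ↦ exists_setWord_eq S hS ha⟩

/-- A sum over the letters of `setWord S` is the sum over `S`. [cite: Warner1983, 2.6] -/
theorem sum_setWord {M : Type*} [AddCommMonoid M] {k : ℕ} (S : Finset Λ) (hS : S.card = k) (g : Λ → M) :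
    ∑ j, g (setWord S hS j) = ∑ a ∈ S, g a := by
  classical
  calc ∑ j, g (setWord S hS j) = ∑ a ∈ Finset.univ.image (setWord S hS), g a :=
        (Finset.sum_image fun i _ j _ h ↦ setWord_injective S hS h).symm
    _ = ∑ a ∈ S, g a := by rw [image_setWord]

/-- The image of an injective word of length `k` has `k` letters. [cite: Warner1983, 2.6] -/
theorem card_image_of_injective_fin [DecidableEq Λ] {k : ℕ} {w : Fin k → Λ} (hw : Injective w) :
    (Finset.univ.image w).card = k := by
  rw [Finset.card_image_of_injective _ hw, Finset.card_univ, Fintype.card_fin]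

/-- **Every injective word with letters in a `k`-set `S` is a reordering of `setWord S`.** [cite: Warner1983, 2.6] -/
theorem exists_perm_setWord_comp_eq {k : ℕ} {w : Fin k → Λ} (hw : Injective w) (S : Finset Λ) (hS : S.card = k)
    (hwS : ∀ j, w j ∈ S) : ∃ π : Equiv.Perm (Fin k), setWord S hS ∘ π = w := by
  set e := S.equivFinOfCardEq hS
  let g : Fin k → Fin k := fun j ↦ e ⟨w j, hwS j⟩
  have hg : Injective g := fun i j h ↦ hw (by
    have h' := e.injective h
    exact congrArg Subtype.val h')
  refine ⟨Equiv.ofBijective g (Finite.injective_iff_bijective.1 hg), funext fun j ↦ ?_⟩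
  simp only [comp_apply, Equiv.ofBijective_apply, setWord, g, e, Equiv.symm_apply_apply]

variable (θ : Λ → (E →L[𝕜] 𝕜')) (c : E [⋀^Fin 0]→L[𝕜] F)

/-- **The set monomial `θ_S ∧ c`** of a `k`-element set of letters (`= θ_{setWord S} ∧ c`; another enumeration of
`S` changes it by a sign only, `wedgeWord_comp_perm`). [cite: Warner1983, 2.6] -/
def setMonomial {k : ℕ} (S : {S : Finset Λ // S.card = k}) : E [⋀^Fin k]→L[𝕜] F :=
  wedgeWord θ c k (setWord S.1 S.2)

/-- Unfolding of `setMonomial`. [cite: Warner1983, 2.6] -/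
theorem setMonomial_eq {k : ℕ} (S : {S : Finset Λ // S.card = k}) :
    setMonomial θ c S = wedgeWord θ c k (setWord S.1 S.2) := rfl

/-- **An injective word's monomial is `±` the set monomial of its letter set.** [cite: Warner1983, 2.6] -/
theorem exists_wedgeWord_eq_sign_smul_setMonomial {k : ℕ} {w : Fin k → Λ} (hw : Injective w) (S : Finset Λ)
    (hS : S.card = k) (hwS : ∀ j, w j ∈ S) :
    ∃ π : Equiv.Perm (Fin k), wedgeWord θ c k w = ((Equiv.Perm.sign π : ℤ) : 𝕜') • setMonomial θ c ⟨S, hS⟩ := by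
  obtain ⟨π, hπ⟩ := exists_perm_setWord_comp_eq hw S hS hwS
  exact ⟨π, by rw [← hπ, wedgeWord_comp_perm, setMonomial_eq]⟩

/-- **The set monomials span what all monomials span** (non-injective words give `0`, injective ones `±` a set
monomial). [cite: Warner1983, 2.6] -/
theorem span_setMonomial_eq [DecidableEq Λ] (k : ℕ) :
    Submodule.span 𝕜' (Set.range (setMonomial θ c (k := k))) = Submodule.span 𝕜' (Set.range (wedgeWord θ c k)) := by
  refine le_antisymm (Submodule.span_mono ?_) (Submodule.span_le.2 ?_)
  · rintro _ ⟨S, rfl⟩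
    exact ⟨setWord S.1 S.2, rfl⟩
  · rintro _ ⟨w, rfl⟩
    by_cases hw : Injective w
    · obtain ⟨π, hπ⟩ := exists_wedgeWord_eq_sign_smul_setMonomial θ c hw (Finset.univ.image w)
        (card_image_of_injective_fin hw) fun j ↦ Finset.mem_image_of_mem w (Finset.mem_univ j)
      rw [SetLike.mem_coe, hπ]
      exact Submodule.smul_mem _ _ (Submodule.subset_span ⟨_, rfl⟩)
    · rw [SetLike.mem_coe, wedgeWord_eq_zero_of_not_injective θ c w hw]
      exact Submodule.zero_mem _

variable [Fintype Λ] {k : ℕ} (hspan : Submodule.span 𝕜' (Set.range (wedgeWord θ c k)) = ⊤)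
  (hdim : Module.finrank 𝕜' (E [⋀^Fin k]→L[𝕜] F) = (Fintype.card Λ).choose k)

/-- **The order-free monomial basis `{θ_S ∧ c : #S = k}` of `E [⋀^Fin k]→L[𝕜] F`**, for an alphabet whose
length-`k` monomials span and whose size is right, `dim = C(#Λ, k)` (Warner 2.6 / Lange–Birkenhake Prop. 1.1.20,
1.1.23, by dimension count: Mathlib's `basisOfTopLeSpanOfCardEqFinrank`).
[cite: Warner1983, 2.6 («a basis of Λ_r(V)»)] -/
def setMonomialBasis [DecidableEq Λ] : Module.Basis {S : Finset Λ // S.card = k} 𝕜' (E [⋀^Fin k]→L[𝕜] F) :=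
  basisOfTopLeSpanOfCardEqFinrank (setMonomial θ c) (by rw [span_setMonomial_eq, hspan])
    (by rw [Fintype.card_finset_len, hdim])

/-- The basis vectors are the set monomials. [cite: Warner1983, 2.6] -/
@[simp] theorem setMonomialBasis_apply [DecidableEq Λ] (S : {S : Finset Λ // S.card = k}) :
    setMonomialBasis θ c hspan hdim S = setMonomial θ c S := by
  rw [setMonomialBasis, coe_basisOfTopLeSpanOfCardEqFinrank]

/-- Coordinates of set monomials: `coord_S (θ_{S'} ∧ c) = δ_{S S'}`. [cite: Warner1983, 2.6] -/
theorem coord_setMonomial [DecidableEq Λ] (S S' : {S : Finset Λ // S.card = k}) :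
    (setMonomialBasis θ c hspan hdim).coord S (setMonomial θ c S') = if S' = S then 1 else 0 := by
  rw [← setMonomialBasis_apply θ c hspan hdim S', Module.Basis.coord_apply, Module.Basis.repr_self_apply]

/-- Coordinates of the monomial of a NON-injective word vanish. [cite: Warner1983, 2.6] -/
theorem coord_wedgeWord_of_not_injective [DecidableEq Λ] (S : {S : Finset Λ // S.card = k}) {w : Fin k → Λ}
    (hw : ¬ Injective w) : (setMonomialBasis θ c hspan hdim).coord S (wedgeWord θ c k w) = 0 := by
  rw [wedgeWord_eq_zero_of_not_injective θ c w hw, map_zero]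

/-- **The `S`-coordinate of the monomial of a word whose letter set is not `S` vanishes.** [cite: Warner1983, 2.6] -/
theorem coord_wedgeWord_eq_zero_of_image_ne [DecidableEq Λ] (S : {S : Finset Λ // S.card = k}) {w : Fin k → Λ}
    (h : Finset.univ.image w ≠ S.1) : (setMonomialBasis θ c hspan hdim).coord S (wedgeWord θ c k w) = 0 := by
  by_cases hw : Injective w
  · obtain ⟨π, hπ⟩ := exists_wedgeWord_eq_sign_smul_setMonomial θ c hw (Finset.univ.image w)
      (card_image_of_injective_fin hw) fun j ↦ Finset.mem_image_of_mem w (Finset.mem_univ j)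
    rw [hπ, map_smul, coord_setMonomial, if_neg fun h' ↦ h (congrArg Subtype.val h'), smul_zero]
  · exact coord_wedgeWord_of_not_injective θ c hspan hdim S hw

/-- The `S`-coordinate of the monomial of an injective word with letters in `S` is a sign.
[cite: Warner1983, 2.6] -/
theorem exists_coord_wedgeWord_eq_sign [DecidableEq Λ] (S : {S : Finset Λ // S.card = k}) {w : Fin k → Λ}
    (hw : Injective w) (hwS : ∀ j, w j ∈ S.1) :
    ∃ π : Equiv.Perm (Fin k),
      (setMonomialBasis θ c hspan hdim).coord S (wedgeWord θ c k w) = ((Equiv.Perm.sign π : ℤ) : 𝕜') := by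
  obtain ⟨π, hπ⟩ := exists_wedgeWord_eq_sign_smul_setMonomial θ c hw S.1 S.2 hwS
  exact ⟨π, by rw [hπ, map_smul, coord_setMonomial, if_pos rfl, smul_eq_mul, mul_one]⟩

/-- **Expansion in the basis**: `η = Σ_S coord_S(η) · (θ_S ∧ c)`. [cite: Warner1983, 2.6] -/
theorem sum_coord_smul_setMonomial [DecidableEq Λ] (η : E [⋀^Fin k]→L[𝕜] F) :
    ∑ S, (setMonomialBasis θ c hspan hdim).coord S η • setMonomial θ c S = η := by
  conv_rhs => rw [← (setMonomialBasis θ c hspan hdim).sum_repr η]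
  simp only [Module.Basis.coord_apply, setMonomialBasis_apply]

end SetWords

/-! ## §2 Leibniz: the action of `ad T` on monomials -/

section AdAction

variable {E : Type*} [NormedAddCommGroup E] [NormedSpace ℝ E] {𝕜' : Type*} [NormedField 𝕜'] [NormedAlgebra ℝ 𝕜']
  {W : Type*} [NormedAddCommGroup W] [NormedSpace ℝ W] [NormedSpace 𝕜' W] [IsScalarTower ℝ 𝕜' W]
  (T : E →L[ℝ] E) (c : E [⋀^Fin 0]→L[ℝ] W)

/-- **Leibniz on monomials**: `ad T (θ₀ ∧ ⋯ ∧ θ_{k-1} ∧ c) = Σⱼ θ₀ ∧ ⋯ ∧ (θⱼ ∘ T) ∧ ⋯ ∧ θ_{k-1} ∧ c`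
(`adAlt_wedgeOne` iterated; `ad T c = 0` in degree `0`). [cite: Verbitsky1996Hyperholomorphic, §1 («using Leibnitz formula»)] -/
theorem adAlt_wedgeSeq : ∀ (k : ℕ) (θs : Fin k → (E →L[ℝ] 𝕜')),
    adAlt T (wedgeSeq c k θs) = ∑ j, wedgeSeq c k (update θs j ((θs j).comp T))
  | 0, θs => by rw [wedgeSeq_zero, adAlt_of_degree_zero, Fin.sum_univ_zero]
  | k + 1, θs => by
    rw [wedgeSeq_succ, adAlt_wedgeOne, adAlt_wedgeSeq k (Fin.tail θs), Fin.sum_univ_succ, wedgeSeq_succ,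
      update_self, Fin.tail_update_zero, ← wedgeOneL_apply (𝕜 := ℝ) (θs 0) (∑ j, _), map_sum]
    congr 1
    refine Finset.sum_congr rfl fun j _ ↦ ?_
    rw [wedgeOneL_apply, wedgeSeq_succ, update_of_ne (Fin.succ_ne_zero j).symm, Fin.tail_update_succ]
    rfl

/-- Leibniz on the monomial of a word. [cite: Verbitsky1996Hyperholomorphic, §1] -/
theorem adAlt_wedgeWord {Λ : Type*} (θ : Λ → (E →L[ℝ] 𝕜')) (k : ℕ) (w : Fin k → Λ) :
    adAlt T (wedgeWord θ c k w) = ∑ j, wedgeSeq c k (update (θ ∘ w) j ((θ (w j)).comp T)) := by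
  rw [wedgeWord_eq_wedgeSeq, adAlt_wedgeSeq]
  rfl

/-- Replacing a letter of a word's sequence by another LETTER gives the monomial of the updated word.
[cite: Warner1983, 2.6] -/
theorem wedgeSeq_update_comp_eq_wedgeWord {Λ : Type*} [DecidableEq Λ] (θ : Λ → (E →L[ℝ] 𝕜')) (k : ℕ)
    (w : Fin k → Λ) (j : Fin k) (a : Λ) :
    wedgeSeq c k (update (θ ∘ w) j (θ a)) = wedgeWord θ c k (update w j a) := by
  rw [wedgeWord_eq_wedgeSeq, comp_update]

/-- **Eigen-letters give eigen-monomials**: if `θⱼ ∘ T = λⱼ θⱼ` for all `j` then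
`ad T (θ₀ ∧ ⋯ ∧ θ_{k-1} ∧ c) = (Σⱼ λⱼ) · θ₀ ∧ ⋯ ∧ θ_{k-1} ∧ c` — the weights of a diagonal operator on `⋀^k`.
[cite: vanGeemen1994HodgeAV, proof of Thm. 6.12 (weights on `∧^k(W ⊕ W^*)`)] -/
theorem adAlt_wedgeSeq_of_comp_eq_smul {k : ℕ} (θs : Fin k → (E →L[ℝ] 𝕜')) (μ : Fin k → 𝕜')
    (h : ∀ j, (θs j).comp T = μ j • θs j) : adAlt T (wedgeSeq c k θs) = (∑ j, μ j) • wedgeSeq c k θs := by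
  rw [adAlt_wedgeSeq, Finset.sum_smul]
  refine Finset.sum_congr rfl fun j _ ↦ ?_
  rw [h j, wedgeSeq_update_smul, update_eq_self]

/-- The same for the monomial of a word in eigen-letters. [cite: vanGeemen1994HodgeAV, proof of Thm. 6.12] -/
theorem adAlt_wedgeWord_of_comp_eq_smul {Λ : Type*} (θ : Λ → (E →L[ℝ] 𝕜')) (μ : Λ → 𝕜')
    (h : ∀ a, (θ a).comp T = μ a • θ a) (k : ℕ) (w : Fin k → Λ) :
    adAlt T (wedgeWord θ c k w) = (∑ j, μ (w j)) • wedgeWord θ c k w := by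
  rw [wedgeWord_eq_wedgeSeq]
  exact adAlt_wedgeSeq_of_comp_eq_smul T c (θ ∘ w) (μ ∘ w) fun j ↦ h (w j)

end AdAction

end Literature.LinearAlgebra.Alternating

end
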